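import Summits.Ventures.PercRepro.ProfilePointedSpanningIdentity

/-!
# PercRepro — THE CONTRACTION STEP OF THE COLOOP LIMIT: THE e-CLASSES OF `𝒦`, THE MOVE BIJECTION, THE DROP IDENTITY,
AND THE CONJECTURES (CM) / (CM⁺)   (p10, gen 15; `proofs/P10-AVFULL.md` §23(h)–(i))

For a finite matroid `M` on `N = #E`, a point `p` and a second element `e ≠ p`, the captured `p`-avoiding family
`𝒦 = capSets M p` splits into four classes by the position of `e`:
  `U₁ = {e ∉ X, e ∉ cl X}` (`e` avoided and free), `U₂ = {e ∉ X, e ∈ cl X}` (captured by `X`),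
  `V₁ = {e ∈ X, e ∉ cl(E ∖ X)}` (`e` inside and free), `V₂ = {e ∈ X, e ∈ cl(E ∖ X)}` (captured by the other side),
and `V₁ = V₁′ ⊔ V₁″` according to whether `p ∈ cl(X ∖ e)` (`V₁″`: `p` is captured only through `e`).
PAPER: `V₁ ≅ BI-captured family of M / e` via `X′ ↦ X′ ∪ {e}`, so `Φ(M / e, p) = Σ_{X ∈ V₁} (2 #X − N − 1)` =: `contractMoment`.
KERNEL: the move `X ↦ X ∪ {e}` is a bijection `U₁ ≃ V₁′` (`card_capU1_eq_capV1'`), whence THE DROP IDENTITY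

  `Σ_{X ∈ 𝒦} (2 #X − N) − contractMoment = Σ_{X ∈ U₂ ∪ V₂} (2 #X − N) + Σ_{X ∈ U₁} (2 #X − N + 1) + #V₁″`  (`drop_identity`).

The CONJECTURES (NOT asserted): (CM) `contractMoment ≤ Σ_{X ∈ 𝒦} (2 #X − N)` («contracting `e` never increases the
coloop limit»; 0 violations on the whole ≤ 9 catalogue, 27,464,256 instances) and the sharper (CM⁺)
`contractMoment + #V₁″ ≤ Σ_{X ∈ 𝒦} (2 #X − N)`; `contractMonotone_of_plus`.  By the paper induction (contract a
partner-free `e`; the doubled free matroids are the terminal case with `Φ = 0`), (CM) for all matroids would give (★),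
hence (C1′) and (L1).  Nothing here asserts (CM), (CM⁺) or (★).
-/

open scoped Matroid

namespace PercRepro.Cogirth

open Finset ThmH Skew

variable {α : Type} [DecidableEq α] {M : Matroid α} [M.Finite]

/-! ### Closure monotonicity on finsets -/

omit [DecidableEq α] in
/-- `clF` is monotone. -/
theorem mem_clF_of_subset {X Y : Finset α} (h : X ⊆ Y) {x : α} (hx : x ∈ clF M X) : x ∈ clF M Y := by
  have h1 : x ∈ M.closure (X : Set α) := by
    rw [← coe_clF]
    exact_mod_cast hx
  have h2 : M.closure (X : Set α) ⊆ M.closure (Y : Set α) :=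
    M.closure_subset_closure (by exact_mod_cast h)
  have h3 : x ∈ M.closure (Y : Set α) := h2 h1
  rw [← coe_clF] at h3
  exact_mod_cast h3

/-! ### The `e`-classes of the captured family -/

/-- `U₁`: captured sets avoiding `e`, with `e` free. -/
noncomputable def capU1 (M : Matroid α) [M.Finite] (p e : α) : Finset (Finset α) :=
  (capSets M p).filter (fun X => e ∉ X ∧ e ∉ clF M X)

/-- `U₂`: captured sets avoiding `e`, with `e` captured by `X`. -/
noncomputable def capU2 (M : Matroid α) [M.Finite] (p e : α) : Finset (Finset α) :=
  (capSets M p).filter (fun X => e ∉ X ∧ e ∈ clF M X)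

/-- `V₁`: captured sets through `e`, with `e` free. -/
noncomputable def capV1 (M : Matroid α) [M.Finite] (p e : α) : Finset (Finset α) :=
  (capSets M p).filter (fun X => e ∈ X ∧ e ∉ clF M (gr M \ X))

/-- `V₂`: captured sets through `e`, with `e` captured by the other side. -/
noncomputable def capV2 (M : Matroid α) [M.Finite] (p e : α) : Finset (Finset α) :=
  (capSets M p).filter (fun X => e ∈ X ∧ e ∈ clF M (gr M \ X))

/-- `V₁′`: the part of `V₁` where `p` stays captured without `e`. -/
noncomputable def capV1a (M : Matroid α) [M.Finite] (p e : α) : Finset (Finset α) :=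
  (capV1 M p e).filter (fun X => p ∈ clF M (X.erase e))

/-- `V₁″`: the part of `V₁` where `p` is captured only through `e`. -/
noncomputable def capV1b (M : Matroid α) [M.Finite] (p e : α) : Finset (Finset α) :=
  (capV1 M p e).filter (fun X => p ∉ clF M (X.erase e))

/-- `Σ_{X ∈ V₁} (2 #X − N − 1)`: on paper, the coloop limit `Φ(M / e, p)` of the contraction. -/
noncomputable def contractMoment (M : Matroid α) [M.Finite] (p e : α) : ℤ :=
  ∑ X ∈ capV1 M p e, (2 * (X.card : ℤ) - (gr M).card - 1)

/-- **(CM) (NOT asserted)**: contracting `e ≠ p` never increases the coloop limit. -/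
def ContractMonotone (α : Type) [DecidableEq α] : Prop :=
  ∀ (M : Matroid α) [M.Finite] (p e : α), p ∈ gr M → e ∈ gr M → e ≠ p →
    contractMoment M p e ≤ ∑ X ∈ capSets M p, (2 * (X.card : ℤ) - (gr M).card)

/-- **(CM⁺) (NOT asserted)**: the drop is at least `#V₁″`. -/
def ContractMonotonePlus (α : Type) [DecidableEq α] : Prop :=
  ∀ (M : Matroid α) [M.Finite] (p e : α), p ∈ gr M → e ∈ gr M → e ≠ p →
    contractMoment M p e + (capV1b M p e).card ≤ ∑ X ∈ capSets M p, (2 * (X.card : ℤ) - (gr M).card)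

/-- (CM⁺) ⟹ (CM). -/
theorem contractMonotone_of_plus (h : ContractMonotonePlus α) : ContractMonotone α := by
  intro M _ p e hp he hep
  have := h M p e hp he hep
  have h0 : (0 : ℤ) ≤ (capV1b M p e).card := by exact_mod_cast Nat.zero_le _
  linarith

/-- Membership in `capSets`, unfolded. -/
theorem mem_capSets {p : α} {X : Finset α} :
    X ∈ capSets M p ↔ (X ∈ biIndepAll M ∧ p ∉ X) ∧ p ∈ clF M X := by
  unfold capSets
  rw [mem_filter, mem_avoidSets]

/-! ### The move bijection `U₁ ≃ V₁′` -/

/-- **THE MOVE ON THE CAPTURED FAMILY**: `X ↦ X ∪ {e}` is a bijection from `U₁` onto `V₁′`. -/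
theorem card_capU1_eq_capV1a {p e : α} (he : e ∈ gr M) (hep : e ≠ p) :
    (capU1 M p e).card = (capV1a M p e).card := by
  unfold capU1 capV1a capV1
  apply card_bij (fun X _ => insert e X)
  · intro X hX
    rw [mem_filter, mem_capSets] at hX
    obtain ⟨⟨⟨hXb, hpX⟩, hpcl⟩, heX, hcl⟩ := hX
    have hins : insert e X ∈ biIndepAll M := (insert_mem_biIndepAll_iff hXb he heX).2 hcl
    rw [mem_filter, mem_filter, mem_capSets]
    refine ⟨⟨⟨⟨hins, ?_⟩, mem_clF_of_subset (subset_insert e X) hpcl⟩, mem_insert_self e X, ?_⟩, ?_⟩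
    · rw [mem_insert, not_or]
      exact ⟨fun h => hep h.symm, hpX⟩
    · have h2 := (erase_mem_biIndepAll_iff hins (mem_insert_self e X)).1
      rw [erase_insert heX] at h2
      exact h2 hXb
    · rw [erase_insert heX]
      exact hpcl
  · intro X₁ hX₁ X₂ hX₂ h
    have h1 : e ∉ X₁ := ((mem_filter.1 hX₁).2).1
    have h2 : e ∉ X₂ := ((mem_filter.1 hX₂).2).1
    rw [← erase_insert h1, ← erase_insert h2, h]
  · intro X' hX'
    rw [mem_filter, mem_filter, mem_capSets] at hX'
    obtain ⟨⟨⟨⟨hXb, hpX⟩, -⟩, heX, hcl⟩, hpcl⟩ := hX'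
    have hXe : X'.erase e ∈ biIndepAll M := (erase_mem_biIndepAll_iff hXb heX).2 hcl
    refine ⟨X'.erase e, ?_, insert_erase heX⟩
    rw [mem_filter, mem_capSets]
    refine ⟨⟨⟨hXe, fun h => hpX (mem_of_mem_erase h)⟩, hpcl⟩, notMem_erase e X', ?_⟩
    have h3 := (insert_mem_biIndepAll_iff hXe he (notMem_erase e X')).1
    rw [insert_erase heX] at h3
    exact h3 hXb

/-! ### The drop identity -/

/-- The captured family is the disjoint union of its four `e`-classes, as a sum. -/
theorem sum_capSets_eq_classes (p e : α) (f : Finset α → ℤ) :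
    ∑ X ∈ capSets M p, f X =
      ∑ X ∈ capU1 M p e, f X + ∑ X ∈ capU2 M p e, f X + ∑ X ∈ capV1 M p e, f X + ∑ X ∈ capV2 M p e, f X := by
  unfold capU1 capU2 capV1 capV2
  have h1 := sum_filter_add_sum_filter_not (capSets M p) (fun X => e ∈ X) f
  have h2 := sum_filter_add_sum_filter_not ((capSets M p).filter (fun X => e ∉ X)) (fun X => e ∈ clF M X) f
  have h3 := sum_filter_add_sum_filter_not ((capSets M p).filter (fun X => e ∈ X))
    (fun X => e ∈ clF M (gr M \ X)) f
  rw [filter_filter, filter_filter] at h2 h3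
  have h2' : ∑ X ∈ (capSets M p).filter (fun X => e ∉ X), f X =
      ∑ X ∈ (capSets M p).filter (fun X => e ∉ X ∧ e ∉ clF M X), f X +
        ∑ X ∈ (capSets M p).filter (fun X => e ∉ X ∧ e ∈ clF M X), f X := by
    rw [add_comm]
    exact h2.symm
  have h3' : ∑ X ∈ (capSets M p).filter (fun X => e ∈ X), f X =
      ∑ X ∈ (capSets M p).filter (fun X => e ∈ X ∧ e ∉ clF M (gr M \ X)), f X +
        ∑ X ∈ (capSets M p).filter (fun X => e ∈ X ∧ e ∈ clF M (gr M \ X)), f X := by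
    rw [add_comm]
    exact h3.symm
  rw [← h1, h2', h3']
  ring

/-- `V₁ = V₁′ ⊔ V₁″`, as a sum. -/
theorem sum_capV1_split (p e : α) (f : Finset α → ℤ) :
    ∑ X ∈ capV1 M p e, f X = ∑ X ∈ capV1a M p e, f X + ∑ X ∈ capV1b M p e, f X := by
  unfold capV1a capV1b
  exact (sum_filter_add_sum_filter_not (capV1 M p e) (fun X => p ∈ clF M (X.erase e)) f).symm

/-- **THE DROP IDENTITY**: `Σ_{𝒦} (2 #X − N) − contractMoment = Σ_{U₂ ∪ V₂} (2 #X − N) + Σ_{U₁} (2 #X − N + 1) + #V₁″`. -/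
theorem drop_identity {p e : α} (he : e ∈ gr M) (hep : e ≠ p) :
    ∑ X ∈ capSets M p, (2 * (X.card : ℤ) - (gr M).card) - contractMoment M p e =
      (∑ X ∈ capU2 M p e, (2 * (X.card : ℤ) - (gr M).card) +
        ∑ X ∈ capV2 M p e, (2 * (X.card : ℤ) - (gr M).card)) +
        ∑ X ∈ capU1 M p e, (2 * (X.card : ℤ) - (gr M).card + 1) + (capV1b M p e).card := by
  unfold contractMoment
  rw [sum_capSets_eq_classes p e, sum_capV1_split p e, sum_capV1_split p e]
  have hV1a : ∑ X ∈ capV1a M p e, (2 * (X.card : ℤ) - (gr M).card) -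
      ∑ X ∈ capV1a M p e, (2 * (X.card : ℤ) - (gr M).card - 1) = (capV1a M p e).card := by
    rw [← sum_sub_distrib]
    simp only [sub_sub_cancel]
    rw [sum_const, nsmul_eq_mul, mul_one]
  have hV1b : ∑ X ∈ capV1b M p e, (2 * (X.card : ℤ) - (gr M).card) -
      ∑ X ∈ capV1b M p e, (2 * (X.card : ℤ) - (gr M).card - 1) = (capV1b M p e).card := by
    rw [← sum_sub_distrib]
    simp only [sub_sub_cancel]
    rw [sum_const, nsmul_eq_mul, mul_one]
  have hU1 : ∑ X ∈ capU1 M p e, (2 * (X.card : ℤ) - (gr M).card + 1) =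
      ∑ X ∈ capU1 M p e, (2 * (X.card : ℤ) - (gr M).card) + (capU1 M p e).card := by
    rw [sum_add_distrib, sum_const, nsmul_eq_mul, mul_one]
  have hcard : ((capU1 M p e).card : ℤ) = (capV1a M p e).card := by
    exact_mod_cast card_capU1_eq_capV1a (M := M) he hep
  rw [hU1, hcard]
  linarith

end PercRepro.Cogirth
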